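import Summits.Ventures.LatticeQCDFlow.Exactness.Phi4FlowSamplerErgodic
import HarnessLib

/-!
# A Gaussian minorant of the flow's density makes the φ⁴ flow sampler uniformly ergodic, with the constant

HONEST FRAMING: exact (Metropolis-corrected) sampling algorithms for lattice gauge theory;
figures of merit are autocorrelation/cost numbers at stated couplings and volumes; no
continuum-physics claim.  (SCALAR calibration rung S0-A: not a gauge result.)

Venture `LatticeQCDFlow` (cell pub-lqcd), topic `Exactness`; FANOUT row 2 (`s0-phi4`, FLOW arm).
NEW WORK of the cell; companion of `Exactness/Phi4FlowSamplerErgodic.lean`, which proves: a weight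
bound `e^{−S} ≤ W·Z·q̃` makes the S0-A flow sampler (`phi4FlowKernel`) exact AND uniformly ergodic,
`|μKᵗ(A) − π(A)| ≤ (1 − W⁻¹)ᵗ`.  Here the hypothesis is DISCHARGED from a property one can read
off a network: a Gaussian lower bound on the model density.

* `latticePhi4Action_coercive_kappa` — for `λ > 0` and ANY real `J`, `κ`:
  `κ Σ_w φ_w² − (n+1)(M_J+κ)²/(4λ) ≤ S(φ)`, `M_J = Σ|J_{yz}|` (the quartic beats every Gaussian;
  `κ = 1` is `Scoring.latticePhi4Action_coercive`);
* `gibbsWeight_le_of_gaussian_minorant` — `q̃ ≥ c e^{−κΣφ²}` (`c > 0`) gives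
  `e^{−S} ≤ (e^{K}/c) q̃`, `K = (n+1)(M_J+κ)²/(4λ)`;
* **`phi4FlowSampler_uniformly_ergodic_of_gaussian_minorant`** — every `λ > 0`, every real `J`
  (the AKS 2019 sets `m² = −4` included), every positive model density with `∫ q̃ = 1` and a
  Gaussian minorant: the flow sampler is exact for `phi4GibbsMeasure J λ` and
  `|μKᵗ(A) − π(A)| ≤ (1 − c Z e^{−K})ᵗ` for every initial law `μ`, every `t`, every set `A`;
* `phi4FlowSampler_acceptMass_ge` — and it accepts from EVERY configuration with probability
  `≥ c Z e^{−K}`.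

Which flows have a Gaussian minorant (remark, not formalised): affine-coupling (real-NVP) layers
with bounded log-scales `|s| ≤ s_max`, affinely bounded shifts and a Gaussian prior — the inverse
map is then affinely bounded, so `q̃(φ) = r(f⁻¹φ)|det ∂f⁻¹| ≥ c e^{−κ|φ|²}`.  A flow whose output
tails are lighter than `e^{−S}` in some direction has `sup e^{−S}/q̃ = ∞`; then (Mengersen–Tweedie
1996 Thm 2.1, converse half, named only) the exact chain is not geometrically ergodic.
NOT CLAIMED: that converse as a theorem; the size of `c, κ` for any trained network; observable-
level autocorrelation times.
-/

namespace Summit.Ventures.LatticeQCDFlow.Exactness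

open MeasureTheory ProbabilityTheory Real Finset
open Summit.Ventures.LatticeQCDFlow.Scoring
open scoped ENNReal

variable {n : ℕ}

/-- **Coercivity against every quadratic** (`λ > 0`, any real `J`, any real `κ`):
`κ Σ_w φ_w² − (n+1)(M_J + κ)²/(4λ) ≤ S(φ)`, `M_J = Σ_{y,z}|J_{yz}|` — the quartic term beats any
Gaussian. -/
theorem latticePhi4Action_coercive_kappa {lam : ℝ} (hlam : 0 < lam)
    (J : Fin (n + 1) → Fin (n + 1) → ℝ) (κ : ℝ) (φ : Fin (n + 1) → ℝ) :
    κ * ∑ w, φ w ^ 2 - (n + 1) * (((∑ y, ∑ z, |J y z|) + κ) ^ 2 / (4 * lam))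
      ≤ latticePhi4Action J lam φ := by
  have hA := quadForm_ge J φ
  set M := ∑ y, ∑ z, |J y z| with hM
  have hsite : ∀ w, (M + κ) * φ w ^ 2 - (M + κ) ^ 2 / (4 * lam) ≤ lam * φ w ^ 4 := by
    intro w
    have h : 0 ≤ lam * (φ w ^ 2 - (M + κ) / (2 * lam)) ^ 2 := by positivity
    have e : lam * (φ w ^ 2 - (M + κ) / (2 * lam)) ^ 2
        = lam * φ w ^ 4 - (M + κ) * φ w ^ 2 + (M + κ) ^ 2 / (4 * lam) := by
      field_simp
      ring
    rw [e] at h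
    linarith
  have hsum : (M + κ) * (∑ w, φ w ^ 2) - (n + 1) * ((M + κ) ^ 2 / (4 * lam))
      ≤ lam * ∑ w, φ w ^ 4 := by
    have h := Finset.sum_le_sum fun w (_ : w ∈ (Finset.univ : Finset (Fin (n + 1)))) => hsite w
    rw [Finset.sum_sub_distrib, Finset.sum_const, Finset.card_univ, Fintype.card_fin,
      nsmul_eq_mul, ← Finset.mul_sum, ← Finset.mul_sum] at h
    push_cast at h
    linarith
  unfold latticePhi4Action
  nlinarith [hA, hsum]

/-- **A Gaussian minorant of the model dominates the target.**  If the model density satisfies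
`c e^{−κ Σφ²} ≤ q̃(φ)` (`c > 0`), then `e^{−S(φ)} ≤ (e^{K}/c) q̃(φ)` with
`K = (n+1)(M_J+κ)²/(4λ)`. -/
theorem gibbsWeight_le_of_gaussian_minorant {lam : ℝ} (hlam : 0 < lam)
    (J : Fin (n + 1) → Fin (n + 1) → ℝ) {q : (Fin (n + 1) → ℝ) → ℝ} {c κ : ℝ} (hc : 0 < c)
    (hqc : ∀ φ, c * Real.exp (-(κ * ∑ w, φ w ^ 2)) ≤ q φ) (φ : Fin (n + 1) → ℝ) :
    gibbsWeight J lam φ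
      ≤ Real.exp ((n + 1) * (((∑ y, ∑ z, |J y z|) + κ) ^ 2 / (4 * lam))) / c * q φ := by
  set K := (n + 1 : ℝ) * (((∑ y, ∑ z, |J y z|) + κ) ^ 2 / (4 * lam)) with hK
  have hS := latticePhi4Action_coercive_kappa hlam J κ φ
  have h1 : gibbsWeight J lam φ ≤ Real.exp K * Real.exp (-(κ * ∑ w, φ w ^ 2)) := by
    rw [gibbsWeight, ← Real.exp_add]
    exact Real.exp_le_exp.2 (by linarith)
  calc gibbsWeight J lam φ ≤ Real.exp K * Real.exp (-(κ * ∑ w, φ w ^ 2)) := h1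
    _ = Real.exp K / c * (c * Real.exp (-(κ * ∑ w, φ w ^ 2))) := by
        field_simp
    _ ≤ Real.exp K / c * q φ :=
        mul_le_mul_of_nonneg_left (hqc φ) (div_nonneg (Real.exp_pos K).le hc.le)

/-- **UNIFORM ERGODICITY FROM A GAUSSIAN MINORANT OF THE MODEL.**  `λ > 0`, any real `J`
(the AKS 2019 sets included); model density `q̃ > 0` measurable with `∫ q̃ = 1` and
`q̃ ≥ c e^{−κΣφ²}` for some `c > 0`, `κ ∈ ℝ`.  Then the flow sampler is exact for the φ⁴ Gibbs
probability measure and converges to it UNIFORMLY in the initial law at the explicit geometric rate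
`|μKᵗ(A) − π(A)| ≤ (1 − c Z e^{−K})ᵗ`, `K = (n+1)(Σ|J|+κ)²/(4λ)`, `Z = ∫ e^{−S}`. -/
theorem phi4FlowSampler_uniformly_ergodic_of_gaussian_minorant {lam : ℝ} (hlam : 0 < lam)
    (J : Fin (n + 1) → Fin (n + 1) → ℝ) {q : (Fin (n + 1) → ℝ) → ℝ} (hq0 : ∀ φ, 0 < q φ)
    (hqm : Measurable q) (hqi : Integrable q) (hq1 : ∫ φ, q φ = 1) {c κ : ℝ} (hc : 0 < c)
    (hqc : ∀ φ, c * Real.exp (-(κ * ∑ w, φ w ^ 2)) ≤ q φ) :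
    haveI := isProbabilityMeasure_flowModel hq0 hqi hq1
    Kernel.Invariant (phi4FlowKernel J lam q) (phi4GibbsMeasure J lam) ∧
      ∀ (μ : Measure (Fin (n + 1) → ℝ)) [IsProbabilityMeasure μ] (t : ℕ)
        (A : Set (Fin (n + 1) → ℝ)),
        |((fun m : Measure (Fin (n + 1) → ℝ) => m.bind (phi4FlowKernel J lam q))^[t] μ).real A
            - (phi4GibbsMeasure J lam).real A|
          ≤ (1 - c * gibbsZ J lam
              * Real.exp (-((n + 1) * (((∑ y, ∑ z, |J y z|) + κ) ^ 2 / (4 * lam))))) ^ t := by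
  have hZ := gibbsZ_pos hlam J
  set K := (n + 1 : ℝ) * (((∑ y, ∑ z, |J y z|) + κ) ^ 2 / (4 * lam)) with hK
  -- weight bound with `W = e^{K}/(c Z)`
  have hW : ∀ φ, gibbsWeight J lam φ ≤ Real.exp K / (c * gibbsZ J lam) * gibbsZ J lam * q φ := by
    intro φ
    have h := gibbsWeight_le_of_gaussian_minorant hlam J hc hqc φ
    calc gibbsWeight J lam φ ≤ Real.exp K / c * q φ := h
      _ = Real.exp K / (c * gibbsZ J lam) * gibbsZ J lam * q φ := by
          field_simp
  have h := phi4FlowSampler_uniformly_ergodic hlam J hq0 hqm hqi hq1 hW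
  refine ⟨h.1, fun μ _ t A => ?_⟩
  have e : (Real.exp K / (c * gibbsZ J lam))⁻¹ = c * gibbsZ J lam * Real.exp (-K) := by
    rw [inv_div, Real.exp_neg]
    field_simp
  have h2 := h.2 μ t A
  rwa [e] at h2

/-- **Acceptance floor on the lattice.**  Under the Gaussian-minorant hypothesis the flow sampler
accepts from EVERY configuration with probability at least `c Z e^{−K}`. -/
theorem phi4FlowSampler_acceptMass_ge {lam : ℝ} (hlam : 0 < lam)
    (J : Fin (n + 1) → Fin (n + 1) → ℝ) {q : (Fin (n + 1) → ℝ) → ℝ} (hq0 : ∀ φ, 0 < q φ)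
    (hqm : Measurable q) {c κ : ℝ} (hc : 0 < c)
    (hqc : ∀ φ, c * Real.exp (-(κ * ∑ w, φ w ^ 2)) ≤ q φ) (φ : Fin (n + 1) → ℝ) :
    ENNReal.ofReal (c * gibbsZ J lam
        * Real.exp (-((n + 1) * (((∑ y, ∑ z, |J y z|) + κ) ^ 2 / (4 * lam)))))
      ≤ imhAcceptMass (flowModel q) (fun φ => gibbsWeight J lam φ / q φ) φ := by
  have hZ := gibbsZ_pos hlam J
  set K := (n + 1 : ℝ) * (((∑ y, ∑ z, |J y z|) + κ) ^ 2 / (4 * lam)) with hK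
  set p : (Fin (n + 1) → ℝ) → ℝ := fun φ => gibbsWeight J lam φ / gibbsZ J lam with hp
  have hpm : Measurable p := (continuous_gibbsWeight J lam).measurable.div_const _
  have hp0 : ∀ φ, 0 < p φ := fun φ => div_pos (gibbsWeight_pos J lam φ) hZ
  haveI hP : IsProbabilityMeasure (volume.withDensity fun φ => ENNReal.ofReal (p φ)) :=
    isProbabilityMeasure_phi4GibbsMeasure hlam J
  have hpW : ∀ ψ, p ψ ≤ Real.exp K / (c * gibbsZ J lam) * q ψ := fun ψ => by
    simp only [hp]
    rw [div_le_iff₀ hZ]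
    calc gibbsWeight J lam ψ ≤ Real.exp K / c * q ψ := gibbsWeight_le_of_gaussian_minorant hlam J hc hqc ψ
      _ = Real.exp K / (c * gibbsZ J lam) * q ψ * gibbsZ J lam := by
          field_simp
  -- the acceptance mass only sees weight ratios
  have hE : imhAcceptE (fun ψ => gibbsWeight J lam ψ / q ψ) = imhAcceptE fun ψ => p ψ / q ψ := by
    have e : (fun ψ => p ψ / q ψ) = fun ψ => (gibbsZ J lam)⁻¹ * (gibbsWeight J lam ψ / q ψ) := by
      funext ψ
      simp only [hp]
      field_simp
    rw [e]
    funext x y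
    simp only [imhAcceptE, imhAccept_const_mul (inv_pos.2 hZ)]
  have hM : imhAcceptMass (flowModel q) (fun ψ => gibbsWeight J lam ψ / q ψ) φ
      = imhAcceptMass (volume.withDensity fun ψ => ENNReal.ofReal (q ψ)) (fun ψ => p ψ / q ψ) φ := by
    simp only [imhAcceptMass, hE]
    rfl
  rw [hM]
  have h := flowMCMC_acceptMass_ge (vol := volume) hpm hqm hp0 hq0 hpW φ
  have e : (ENNReal.ofReal (Real.exp K / (c * gibbsZ J lam)))⁻¹
      = ENNReal.ofReal (c * gibbsZ J lam * Real.exp (-K)) := by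
    rw [← ENNReal.ofReal_inv_of_pos (div_pos (Real.exp_pos K) (mul_pos hc hZ)), inv_div,
      Real.exp_neg, div_eq_mul_inv]
  rwa [e] at h

end Summit.Ventures.LatticeQCDFlow.Exactness
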